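import Summits.Parity.GeneralizedHardyLittlewood.Theorems.BeyondDiagonalBeatsQuarter.OffDiagCoreWinUnitBox
import HarnessLib

/-!
# Route `PrimeLevelFamEdge`, crux K_B (stmt-Parity-20343), line `diagonal_kernel_split` rev 4, plan Ω,
# node **L7d part 2, leaf F0 — the unit-box integrand of a member is INTEGRABLE (both layers), so a finite family
# sum passes under the unit-box integral** (L7D-PLAN rev 6 §6 F0; companion of S₄ `levelLargePart_boxTransform_eq_unitBox`)

S₄ writes one member's `levelLargePart` against the box transform as `(K₁K₂)•∫dτ₁∫dτ₂ I_x(τ₁,τ₂)` with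
`I_x(τ) = Kern_x(τ)·levelLargePart R Q (g·Ψ_τ(x;1/·)) n a`. The family large sieve acts on `Σ_x W_x·levelLargePart(…)`
POINTWISE in `τ`, so the finite member sum must pass under `∫dτ₁∫dτ₂`; this needs the integrability of `I_x` in `τ₂`
for each `τ₁` and of `τ₁ ↦ ∫dτ₂ I_x`. Both follow from prover-8's cell-level facts
(`integrable_kernel_mul_boxWeight`, `integrable_integral_kernel_mul_boxWeight`: the dual integrand is continuous with
compact support), his pointwise identity `kernel_mul_boxWeight_eq`, and the rescaling `t_j = K_jτ_j`
(`Integrable.comp_mul_left'`, `Measure.integral_comp_mul_left`):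

* `integrable_cellIntegrand`, `integrable_integral_cellIntegrand` — the cell form (`t`-variables);
* **`integrable_unitBoxIntegrand`**, **`integrable_integral_unitBoxIntegrand`** — the unit-box form with a finite level sum;
* **`integrable_unitBox_levelLargePart`**, **`integrable_integral_unitBox_levelLargePart`** — the `levelLargePart` form of S₄.

Helper; standard axioms; closes nothing. «The programme SEARCHES and TYPES; no claim about Landau–Siegel zeros,
Theorems 1–2 of arXiv:2211.02515 or a repaired Margin232 until a kernel theorem says so.»
-/

noncomputable section

open Finset Real Complex MeasureTheory
open scoped Nat

namespace Summit.Parity.GeneralizedHardyLittlewood.Theorems.BeyondDiagonalBeatsQuarter.OffDiag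

open Literature.Analysis.FunctionSpaces (besselJ)
open Literature.Analysis.Calculus.WhitneyConvex (dyadicBump)
open Literature.NumberTheory.LFunctions.KMV2000 (cutoffW)
open Literature.NumberTheory.Sieve.FriedlanderIwaniecPrimes (fourier2 ker)
open LevelSeparation (kernel_mul_boxWeight_eq integrable_kernel_mul_boxWeight integrable_integral_kernel_mul_boxWeight)

section Cell

variable {d₁ d₂ α β r : ℕ}

/-- The cell integrand `K(t)·Σ_{q∈S} c_q Ψ_t(1/q)` is the finite sum of the dual integrands
`c_q·e(−t₁X₁/q)·e(−t₂(σ+X₂/q))·Φ_q(t)` (prover-8's `kernel_mul_boxWeight_eq`, reversed). [folklore] -/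
theorem cellIntegrand_eq_sum (i : ℕ × ℕ) (X₁ σ X₂ : ℝ) (S : Finset ℕ) (c : ℕ → ℂ) (t₁ t₂ : ℝ) :
    (((dyadicBump (t₁ / 2 ^ i.1) * dyadicBump (t₂ / 2 ^ i.2) *
          (((d₁ : ℝ) * t₁ * ((d₂ : ℝ) * t₂)) ^ (-(1 / 2 : ℝ)) * (r : ℝ)⁻¹) : ℝ) : ℂ) * ker t₂ σ) *
        ∑ q ∈ S, c q *
          (((cutoffW ((4 * π ^ 2 * ((d₁ : ℝ) * t₁ * ((d₂ : ℝ) * t₂))) * ((q : ℝ))⁻¹) : ℝ) : ℂ) *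
            ((besselJ 1 ((4 * π * Real.sqrt ((α : ℝ) * t₁ * ((β : ℝ) * t₂)) / r) * ((q : ℝ))⁻¹) : ℝ) : ℂ) *
              Complex.exp (((-2 * π * (t₁ * X₁ + t₂ * X₂) * ((q : ℝ))⁻¹ : ℝ) : ℂ) * I)) =
      ∑ q ∈ S, c q * (ker t₁ (X₁ * ((q : ℝ))⁻¹) * (ker t₂ (σ + X₂ * ((q : ℝ))⁻¹) * boxWeight q d₁ d₂ α β r i t₁ t₂)) := by
  rw [Finset.mul_sum]
  refine Finset.sum_congr rfl fun q _ ↦ ?_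
  rw [kernel_mul_boxWeight_eq]
  ring

/-- **The cell integrand is integrable in `t₂`** (for `d₁, d₂, α, β ≥ 1`, levels `q ≠ 0`). [folklore] -/
theorem integrable_cellIntegrand (hd₁ : 1 ≤ d₁) (hd₂ : 1 ≤ d₂) (hα : 1 ≤ α) (hβ : 1 ≤ β) (i : ℕ × ℕ)
    (X₁ σ X₂ : ℝ) (S : Finset ℕ) (hS : ∀ q ∈ S, q ≠ 0) (c : ℕ → ℂ) (t₁ : ℝ) :
    Integrable (fun t₂ : ℝ ↦ (((dyadicBump (t₁ / 2 ^ i.1) * dyadicBump (t₂ / 2 ^ i.2) *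
          (((d₁ : ℝ) * t₁ * ((d₂ : ℝ) * t₂)) ^ (-(1 / 2 : ℝ)) * (r : ℝ)⁻¹) : ℝ) : ℂ) * ker t₂ σ) *
        ∑ q ∈ S, c q *
          (((cutoffW ((4 * π ^ 2 * ((d₁ : ℝ) * t₁ * ((d₂ : ℝ) * t₂))) * ((q : ℝ))⁻¹) : ℝ) : ℂ) *
            ((besselJ 1 ((4 * π * Real.sqrt ((α : ℝ) * t₁ * ((β : ℝ) * t₂)) / r) * ((q : ℝ))⁻¹) : ℝ) : ℂ) *
              Complex.exp (((-2 * π * (t₁ * X₁ + t₂ * X₂) * ((q : ℝ))⁻¹ : ℝ) : ℂ) * I))) := by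
  have heq := fun t₂ ↦ cellIntegrand_eq_sum (d₁ := d₁) (d₂ := d₂) (α := α) (β := β) (r := r) i X₁ σ X₂ S c t₁ t₂
  rw [show (fun t₂ : ℝ ↦ _) = fun t₂ ↦ ∑ q ∈ S, c q * (ker t₁ (X₁ * ((q : ℝ))⁻¹) *
      (ker t₂ (σ + X₂ * ((q : ℝ))⁻¹) * boxWeight q d₁ d₂ α β r i t₁ t₂)) from funext heq]
  refine integrable_finsetSum _ fun q hq ↦ ?_
  haveI : NeZero q := ⟨hS q hq⟩
  exact (integrable_kernel_mul_boxWeight (q := q) (r := r) hd₁ hd₂ hα hβ i _ _ t₁).const_mul (c q)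

/-- **The `t₂`-integral of the cell integrand is integrable in `t₁`.** [folklore] -/
theorem integrable_integral_cellIntegrand (hd₁ : 1 ≤ d₁) (hd₂ : 1 ≤ d₂) (hα : 1 ≤ α) (hβ : 1 ≤ β) (i : ℕ × ℕ)
    (X₁ σ X₂ : ℝ) (S : Finset ℕ) (hS : ∀ q ∈ S, q ≠ 0) (c : ℕ → ℂ) :
    Integrable (fun t₁ : ℝ ↦ ∫ t₂, (((dyadicBump (t₁ / 2 ^ i.1) * dyadicBump (t₂ / 2 ^ i.2) *
          (((d₁ : ℝ) * t₁ * ((d₂ : ℝ) * t₂)) ^ (-(1 / 2 : ℝ)) * (r : ℝ)⁻¹) : ℝ) : ℂ) * ker t₂ σ) *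
        ∑ q ∈ S, c q *
          (((cutoffW ((4 * π ^ 2 * ((d₁ : ℝ) * t₁ * ((d₂ : ℝ) * t₂))) * ((q : ℝ))⁻¹) : ℝ) : ℂ) *
            ((besselJ 1 ((4 * π * Real.sqrt ((α : ℝ) * t₁ * ((β : ℝ) * t₂)) / r) * ((q : ℝ))⁻¹) : ℝ) : ℂ) *
              Complex.exp (((-2 * π * (t₁ * X₁ + t₂ * X₂) * ((q : ℝ))⁻¹ : ℝ) : ℂ) * I))) := by
  have hint₂ : ∀ q ∈ S, ∀ t₁ : ℝ, Integrable (fun t₂ : ℝ ↦ c q * (ker t₁ (X₁ * ((q : ℝ))⁻¹) *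
      (ker t₂ (σ + X₂ * ((q : ℝ))⁻¹) * boxWeight q d₁ d₂ α β r i t₁ t₂))) := by
    intro q hq t₁
    haveI : NeZero q := ⟨hS q hq⟩
    exact (integrable_kernel_mul_boxWeight (q := q) (r := r) hd₁ hd₂ hα hβ i _ _ t₁).const_mul (c q)
  have hint₁ : ∀ q ∈ S, Integrable (fun t₁ : ℝ ↦ ∫ t₂, c q * (ker t₁ (X₁ * ((q : ℝ))⁻¹) *
      (ker t₂ (σ + X₂ * ((q : ℝ))⁻¹) * boxWeight q d₁ d₂ α β r i t₁ t₂))) := by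
    intro q hq
    haveI : NeZero q := ⟨hS q hq⟩
    have h := (integrable_integral_kernel_mul_boxWeight (q := q) (r := r) hd₁ hd₂ hα hβ i
      (X₁ * ((q : ℝ))⁻¹) (σ + X₂ * ((q : ℝ))⁻¹)).const_mul (c q)
    refine h.congr (Filter.Eventually.of_forall fun t₁ ↦ ?_)
    dsimp only
    rw [← integral_const_mul]
  have heq : (fun t₁ : ℝ ↦ ∫ t₂, (((dyadicBump (t₁ / 2 ^ i.1) * dyadicBump (t₂ / 2 ^ i.2) *
          (((d₁ : ℝ) * t₁ * ((d₂ : ℝ) * t₂)) ^ (-(1 / 2 : ℝ)) * (r : ℝ)⁻¹) : ℝ) : ℂ) * ker t₂ σ) *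
        ∑ q ∈ S, c q *
          (((cutoffW ((4 * π ^ 2 * ((d₁ : ℝ) * t₁ * ((d₂ : ℝ) * t₂))) * ((q : ℝ))⁻¹) : ℝ) : ℂ) *
            ((besselJ 1 ((4 * π * Real.sqrt ((α : ℝ) * t₁ * ((β : ℝ) * t₂)) / r) * ((q : ℝ))⁻¹) : ℝ) : ℂ) *
              Complex.exp (((-2 * π * (t₁ * X₁ + t₂ * X₂) * ((q : ℝ))⁻¹ : ℝ) : ℂ) * I))) =
      fun t₁ ↦ ∑ q ∈ S, ∫ t₂, c q * (ker t₁ (X₁ * ((q : ℝ))⁻¹) *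
        (ker t₂ (σ + X₂ * ((q : ℝ))⁻¹) * boxWeight q d₁ d₂ α β r i t₁ t₂)) := by
    funext t₁
    rw [← integral_finsetSum _ (fun q hq ↦ hint₂ q hq t₁)]
    exact integral_congr_ae (Filter.Eventually.of_forall fun t₂ ↦
      cellIntegrand_eq_sum (d₁ := d₁) (d₂ := d₂) (α := α) (β := β) (r := r) i X₁ σ X₂ S c t₁ t₂)
  rw [heq]
  exact integrable_finsetSum _ hint₁

end Cell

/-! ### The unit-box form -/

section UnitBox

variable {l m d₁ d₂ : ℕ}

/-- **The unit-box integrand of a switched cell with a finite level sum is integrable in `τ₂`** (`l, m ≥ 1`, `d₁ ∣ l`,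
`d₂ ∣ m`, levels `q ≠ 0`). [folklore] -/
theorem integrable_unitBoxIntegrand (hl : 1 ≤ l) (hm : 1 ≤ m) (hd₁ : d₁ ∣ l) (hd₂ : d₂ ∣ m) (r : ℕ) (i : ℕ × ℕ)
    (h₁ s : ℤ) (A : ℝ) (S : Finset ℕ) (hS : ∀ q ∈ S, q ≠ 0) (c : ℕ → ℂ) (τ₁ : ℝ) :
    Integrable (fun τ₂ : ℝ ↦ (((dyadicBump τ₁ * dyadicBump τ₂ *
            (((d₁ : ℝ) * (2 ^ i.1 * τ₁) * ((d₂ : ℝ) * (2 ^ i.2 * τ₂))) ^ (-(1 / 2 : ℝ)) * (((r + 1 : ℕ) : ℝ))⁻¹) : ℝ) : ℂ) *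
              ker (2 ^ i.2 * τ₂) ((s : ℝ) / h₁)) *
          ∑ q ∈ S, c q *
            (((cutoffW ((4 * π ^ 2 * ((d₁ : ℝ) * (2 ^ i.1 * τ₁) * ((d₂ : ℝ) * (2 ^ i.2 * τ₂)))) * ((q : ℝ))⁻¹) : ℝ) : ℂ) *
              ((besselJ 1 ((4 * π * Real.sqrt (((l / d₁ : ℕ) : ℝ) * (2 ^ i.1 * τ₁) * (((m / d₂ : ℕ) : ℝ) * (2 ^ i.2 * τ₂))) /
                  ((r + 1 : ℕ) : ℝ)) * ((q : ℝ))⁻¹) : ℝ) : ℂ) *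
                Complex.exp (((-2 * π * ((2 ^ i.1 * τ₁) * ((h₁ : ℝ) / (r + 1)) + (2 ^ i.2 * τ₂) * (A / ((h₁ : ℝ) * (r + 1)))) *
                  ((q : ℝ))⁻¹ : ℝ) : ℂ) * I))) := by
  have hd₁1 : 1 ≤ d₁ := Nat.pos_of_dvd_of_pos hd₁ hl
  have hd₂1 : 1 ≤ d₂ := Nat.pos_of_dvd_of_pos hd₂ hm
  have hα : 1 ≤ l / d₁ := Nat.div_pos (Nat.le_of_dvd hl hd₁) hd₁1
  have hβ : 1 ≤ m / d₂ := Nat.div_pos (Nat.le_of_dvd hm hd₂) hd₂1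
  have hK₂ : (2 : ℝ) ^ i.2 ≠ 0 := by positivity
  have h := (integrable_cellIntegrand (r := r + 1) hd₁1 hd₂1 hα hβ i ((h₁ : ℝ) / (r + 1)) ((s : ℝ) / h₁)
    (A / ((h₁ : ℝ) * (r + 1))) S hS c (2 ^ i.1 * τ₁)).comp_mul_left' hK₂
  refine h.congr (Filter.Eventually.of_forall fun τ₂ ↦ ?_)
  have e1 : (2 : ℝ) ^ i.1 * τ₁ / 2 ^ i.1 = τ₁ := by field_simp
  have e2 : (2 : ℝ) ^ i.2 * τ₂ / 2 ^ i.2 = τ₂ := by field_simp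
  simp only [e1, e2, Nat.cast_add, Nat.cast_one]

/-- **The `τ₂`-integral of the unit-box integrand is integrable in `τ₁`.** [folklore] -/
theorem integrable_integral_unitBoxIntegrand (hl : 1 ≤ l) (hm : 1 ≤ m) (hd₁ : d₁ ∣ l) (hd₂ : d₂ ∣ m) (r : ℕ)
    (i : ℕ × ℕ) (h₁ s : ℤ) (A : ℝ) (S : Finset ℕ) (hS : ∀ q ∈ S, q ≠ 0) (c : ℕ → ℂ) :
    Integrable (fun τ₁ : ℝ ↦ ∫ τ₂, (((dyadicBump τ₁ * dyadicBump τ₂ *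
            (((d₁ : ℝ) * (2 ^ i.1 * τ₁) * ((d₂ : ℝ) * (2 ^ i.2 * τ₂))) ^ (-(1 / 2 : ℝ)) * (((r + 1 : ℕ) : ℝ))⁻¹) : ℝ) : ℂ) *
              ker (2 ^ i.2 * τ₂) ((s : ℝ) / h₁)) *
          ∑ q ∈ S, c q *
            (((cutoffW ((4 * π ^ 2 * ((d₁ : ℝ) * (2 ^ i.1 * τ₁) * ((d₂ : ℝ) * (2 ^ i.2 * τ₂)))) * ((q : ℝ))⁻¹) : ℝ) : ℂ) *
              ((besselJ 1 ((4 * π * Real.sqrt (((l / d₁ : ℕ) : ℝ) * (2 ^ i.1 * τ₁) * (((m / d₂ : ℕ) : ℝ) * (2 ^ i.2 * τ₂))) /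
                  ((r + 1 : ℕ) : ℝ)) * ((q : ℝ))⁻¹) : ℝ) : ℂ) *
                Complex.exp (((-2 * π * ((2 ^ i.1 * τ₁) * ((h₁ : ℝ) / (r + 1)) + (2 ^ i.2 * τ₂) * (A / ((h₁ : ℝ) * (r + 1)))) *
                  ((q : ℝ))⁻¹ : ℝ) : ℂ) * I))) := by
  have hd₁1 : 1 ≤ d₁ := Nat.pos_of_dvd_of_pos hd₁ hl
  have hd₂1 : 1 ≤ d₂ := Nat.pos_of_dvd_of_pos hd₂ hm
  have hα : 1 ≤ l / d₁ := Nat.div_pos (Nat.le_of_dvd hl hd₁) hd₁1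
  have hβ : 1 ≤ m / d₂ := Nat.div_pos (Nat.le_of_dvd hm hd₂) hd₂1
  have hK₁ : (2 : ℝ) ^ i.1 ≠ 0 := by positivity
  have hK₂ : (2 : ℝ) ^ i.2 ≠ 0 := by positivity
  -- the cell-form `t₁ ↦ ∫dt₂`, rescaled in `t₁`, times the Jacobian `|K₂⁻¹|` of the inner rescaling
  set G : ℝ → ℂ := fun t₁ ↦ ∫ t₂, (((dyadicBump (t₁ / 2 ^ i.1) * dyadicBump (t₂ / 2 ^ i.2) *
          (((d₁ : ℝ) * t₁ * ((d₂ : ℝ) * t₂)) ^ (-(1 / 2 : ℝ)) * (((r + 1 : ℕ) : ℝ))⁻¹) : ℝ) : ℂ) * ker t₂ ((s : ℝ) / h₁)) *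
        ∑ q ∈ S, c q *
          (((cutoffW ((4 * π ^ 2 * ((d₁ : ℝ) * t₁ * ((d₂ : ℝ) * t₂))) * ((q : ℝ))⁻¹) : ℝ) : ℂ) *
            ((besselJ 1 ((4 * π * Real.sqrt (((l / d₁ : ℕ) : ℝ) * t₁ * (((m / d₂ : ℕ) : ℝ) * t₂)) / ((r + 1 : ℕ) : ℝ)) *
                ((q : ℝ))⁻¹) : ℝ) : ℂ) *
              Complex.exp (((-2 * π * (t₁ * ((h₁ : ℝ) / (r + 1)) + t₂ * (A / ((h₁ : ℝ) * (r + 1)))) *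
                ((q : ℝ))⁻¹ : ℝ) : ℂ) * I)) with hG
  have hGint : Integrable G := by
    have := integrable_integral_cellIntegrand (r := r + 1) hd₁1 hd₂1 hα hβ i ((h₁ : ℝ) / (r + 1)) ((s : ℝ) / h₁)
      (A / ((h₁ : ℝ) * (r + 1))) S hS c
    simpa only [hG, Nat.cast_add, Nat.cast_one] using this
  have h := ((hGint.comp_mul_left' hK₁).smul (|((2 : ℝ) ^ i.2)⁻¹|))
  refine h.congr (Filter.Eventually.of_forall fun τ₁ ↦ ?_)
  simp only [hG, Pi.smul_apply]
  rw [← Measure.integral_comp_mul_left _ ((2 : ℝ) ^ i.2)]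
  refine integral_congr_ae (Filter.Eventually.of_forall fun τ₂ ↦ ?_)
  have e1 : (2 : ℝ) ^ i.1 * τ₁ / 2 ^ i.1 = τ₁ := by field_simp
  have e2 : (2 : ℝ) ^ i.2 * τ₂ / 2 ^ i.2 = τ₂ := by field_simp
  simp only [e1, e2, Nat.cast_add, Nat.cast_one]

/-- **S₄'s integrand — `Kern_x(τ)·levelLargePart R Q (g·Ψ_τ) n a` — is integrable in `τ₂`** (levels `q ≠ 0`).
[folklore] -/
theorem integrable_unitBox_levelLargePart (hl : 1 ≤ l) (hm : 1 ≤ m) (hd₁ : d₁ ∣ l) (hd₂ : d₂ ∣ m) (r : ℕ)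
    (i : ℕ × ℕ) (h₁ s : ℤ) (R : ℕ) (Q : Finset ℕ) (hQ : ∀ q ∈ Q, q ≠ 0) (g : ℕ → ℂ) {n : ℕ} (a : ZMod n)
    (τ₁ : ℝ) :
    Integrable (fun τ₂ : ℝ ↦ (((dyadicBump τ₁ * dyadicBump τ₂ *
            (((d₁ : ℝ) * (2 ^ i.1 * τ₁) * ((d₂ : ℝ) * (2 ^ i.2 * τ₂))) ^ (-(1 / 2 : ℝ)) * (((r + 1 : ℕ) : ℝ))⁻¹) : ℝ) : ℂ) *
              ker (2 ^ i.2 * τ₂) ((s : ℝ) / h₁)) *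
          levelLargePart R Q (fun q ↦ g q *
            (((cutoffW ((4 * π ^ 2 * ((d₁ : ℝ) * (2 ^ i.1 * τ₁) * ((d₂ : ℝ) * (2 ^ i.2 * τ₂)))) * ((q : ℝ))⁻¹) : ℝ) : ℂ) *
              ((besselJ 1 ((4 * π * Real.sqrt (((l / d₁ : ℕ) : ℝ) * (2 ^ i.1 * τ₁) * (((m / d₂ : ℕ) : ℝ) * (2 ^ i.2 * τ₂))) /
                  ((r + 1 : ℕ) : ℝ)) * ((q : ℝ))⁻¹) : ℝ) : ℂ) *
                Complex.exp (((-2 * π * ((2 ^ i.1 * τ₁) * ((h₁ : ℝ) / (r + 1)) +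
                    (2 ^ i.2 * τ₂) * ((((l / d₁ : ℕ) : ℤ) * (m / d₂ : ℕ) : ℝ) / ((h₁ : ℝ) * (r + 1)))) *
                  ((q : ℝ))⁻¹ : ℝ) : ℂ) * I))) n a) := by
  refine (integrable_unitBoxIntegrand hl hm hd₁ hd₂ r i h₁ s ((((l / d₁ : ℕ) : ℤ) * (m / d₂ : ℕ) : ℝ)) Q hQ
    (fun q ↦ levelLargePart R {q} (fun _ ↦ (1 : ℂ)) n a * g q) τ₁).congr
    (Filter.Eventually.of_forall fun τ₂ ↦ ?_)
  dsimp only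
  congr 1
  rw [← sum_levelLargePart_singleton_mul Q _ n R a]
  exact Finset.sum_congr rfl fun q _ ↦ by ring

/-- **The `τ₂`-integral of S₄'s integrand is integrable in `τ₁`.** [folklore] -/
theorem integrable_integral_unitBox_levelLargePart (hl : 1 ≤ l) (hm : 1 ≤ m) (hd₁ : d₁ ∣ l) (hd₂ : d₂ ∣ m)
    (r : ℕ) (i : ℕ × ℕ) (h₁ s : ℤ) (R : ℕ) (Q : Finset ℕ) (hQ : ∀ q ∈ Q, q ≠ 0) (g : ℕ → ℂ) {n : ℕ}
    (a : ZMod n) :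
    Integrable (fun τ₁ : ℝ ↦ ∫ τ₂, (((dyadicBump τ₁ * dyadicBump τ₂ *
            (((d₁ : ℝ) * (2 ^ i.1 * τ₁) * ((d₂ : ℝ) * (2 ^ i.2 * τ₂))) ^ (-(1 / 2 : ℝ)) * (((r + 1 : ℕ) : ℝ))⁻¹) : ℝ) : ℂ) *
              ker (2 ^ i.2 * τ₂) ((s : ℝ) / h₁)) *
          levelLargePart R Q (fun q ↦ g q *
            (((cutoffW ((4 * π ^ 2 * ((d₁ : ℝ) * (2 ^ i.1 * τ₁) * ((d₂ : ℝ) * (2 ^ i.2 * τ₂)))) * ((q : ℝ))⁻¹) : ℝ) : ℂ) *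
              ((besselJ 1 ((4 * π * Real.sqrt (((l / d₁ : ℕ) : ℝ) * (2 ^ i.1 * τ₁) * (((m / d₂ : ℕ) : ℝ) * (2 ^ i.2 * τ₂))) /
                  ((r + 1 : ℕ) : ℝ)) * ((q : ℝ))⁻¹) : ℝ) : ℂ) *
                Complex.exp (((-2 * π * ((2 ^ i.1 * τ₁) * ((h₁ : ℝ) / (r + 1)) +
                    (2 ^ i.2 * τ₂) * ((((l / d₁ : ℕ) : ℤ) * (m / d₂ : ℕ) : ℝ) / ((h₁ : ℝ) * (r + 1)))) *
                  ((q : ℝ))⁻¹ : ℝ) : ℂ) * I))) n a) := by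
  refine (integrable_integral_unitBoxIntegrand hl hm hd₁ hd₂ r i h₁ s ((((l / d₁ : ℕ) : ℤ) * (m / d₂ : ℕ) : ℝ))
    Q hQ (fun q ↦ levelLargePart R {q} (fun _ ↦ (1 : ℂ)) n a * g q)).congr
    (Filter.Eventually.of_forall fun τ₁ ↦ ?_)
  refine integral_congr_ae (Filter.Eventually.of_forall fun τ₂ ↦ ?_)
  dsimp only
  congr 1
  rw [← sum_levelLargePart_singleton_mul Q _ n R a]
  exact Finset.sum_congr rfl fun q _ ↦ by ring

end UnitBox

end Summit.Parity.GeneralizedHardyLittlewood.Theorems.BeyondDiagonalBeatsQuarter.OffDiag
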